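import Summits.NavierStokesRegularity.NavierStokesRegularity.Theses.TypeILiouville
import Summits.NavierStokesRegularity.NavierStokesRegularity.Theorems.RungReynoldsOne.Negative.WithoutLerayHopfFalse

/-!
# `TypeIliouvilleNoTypeII` (stmt-NavierStokesRegularity-0056): the Leray–Hopf hypothesis is load-bearing

Negative (support) lemmas for the crux `TypeILiouville.TypeIliouvilleNoTypeII` (= the `NoTypeII`
shared by `SqueezeCycle`, `TypeICertificateLadder`, … — the same term), extracted from the crux
work file `Cruxes/TypeIliouvilleNoTypeII/Disproof.lean` (cdisprove seat, cycle 1).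

* `typeIliouvilleNoTypeII_false_without_lerayHopf`: the crux with `IsLerayHopfOn T ν 0 (u 0) u`
  deleted is FALSE.  Witness: the Type-II member `g(t) = (1 − t)⁻¹ − 1` of the parasitic drift
  family `u = g(t)·e₁`, `p = −g′(t) x₁` of Koch–Nadirashvili–Seregin–Šverák (Acta Math. 203
  (2009), §1, arXiv:0709.3599 p. 3), built on the drift API of
  `Theorems/RungReynoldsOne/Negative/WithoutLerayHopfFalse.lean`: classical on `[0, 1) × EuclideanSpace ℝ (Fin 3)` from
  the datum `0`, no classical extension past `1`, and `√(1 − t)‖u(t)‖ = t/√(1 − t) → ∞`.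
  So any proof of the crux must use the energy class.
* `pos_of_isMaximalSmoothSolution`: the hypothesis `0 < T` of the crux is redundant — a maximal
  smooth solution has positive lifespan (for `T ≤ 0` the zero flow on `[0, 1)` is an extension).
[cite: KochNadirashviliSereginSverak2009, §1 p. 3 (parasitic solutions)]
-/

noncomputable section

namespace Summit.NavierStokesRegularity.NavierStokesRegularity.Theorems.TypeIliouvilleNoTypeIINegative

open Set Filter Topology Function
open scoped ContDiff
open Literature.Analysis.FluidPDE
open Summit.NavierStokesRegularity.NavierStokesRegularity.Theorems.RungReynoldsOneNegative

/-! ## `0 < T` is redundant -/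

/-- **`0 < T` is redundant in the crux**: a maximal smooth solution has positive lifespan, because
for `T ≤ 0` the zero flow on `[0, 1)` is a classical extension (the agreement on `[0, T) = ∅` is
vacuous). [folklore] -/
theorem pos_of_isMaximalSmoothSolution {ν T : ℝ} {u : ℝ → EuclideanSpace ℝ (Fin 3) → EuclideanSpace ℝ (Fin 3)} {p : ℝ → EuclideanSpace ℝ (Fin 3) → ℝ}
    (h : IsMaximalSmoothSolution ν 0 u p T) : 0 < T := by
  by_contra hT
  have hT' : T ≤ 0 := not_lt.1 hT
  apply h.2
  refine ⟨1, by linarith, fun _ _ => 0, fun _ _ => 0, ?_, fun t ht => ?_⟩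
  · refine ⟨contDiffOn_const, contDiffOn_const, fun t _ x => ?_, fun t _ x => ?_⟩
    · simp [timeDerivWithin, convect]
    · simp [VectorCalculus.divergence]
  · exact absurd (ht.1.trans_lt ht.2) (not_lt.2 hT')

/-! ## The Type-II drift -/

/-! The Type-II amplitude is `g(t) = (1 − t)⁻¹ − 1`, written inline as
`fun s : ℝ => (1 - s)⁻¹ - 1` (no auxiliary definition): smooth on `(-∞, 1)`, `g(0) = 0`,
`(1 − t) g(t) = t`, `g(t) → +∞` as `t ↑ 1`. -/

/-- `g(0) = 0`. [folklore] -/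
theorem gII_zero : ((1 : ℝ) - 0)⁻¹ - 1 = 0 := by simp

/-- `g` is smooth on `(-∞, 1)`. [folklore] -/
theorem gII_contDiffOn : ContDiffOn ℝ ∞ (fun s : ℝ => (1 - s)⁻¹ - 1) (Iio 1) := by
  intro t ht
  have h1 : ContDiffAt ℝ ∞ (fun s : ℝ => (1 - s)⁻¹) t :=
    (contDiffAt_const.sub contDiffAt_id).inv (sub_pos.2 (show t < 1 from ht)).ne'
  exact (h1.sub contDiffAt_const).contDiffWithinAt

/-- `(1 − t) g(t) = t` for `t < 1`. [folklore] -/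
theorem one_sub_mul_gII {t : ℝ} (ht : t < 1) : (1 - t) * ((1 - t)⁻¹ - 1) = t := by
  have h : (1 - t) ≠ 0 := (sub_pos.2 ht).ne'
  field_simp
  ring

/-- `g ≥ 0` on `[0, 1)`. [folklore] -/
theorem gII_nonneg {t : ℝ} (ht0 : 0 ≤ t) (ht : t < 1) : 0 ≤ (1 - t)⁻¹ - 1 := by
  have h := one_sub_mul_gII ht
  have h1 : 0 < 1 - t := sub_pos.2 ht
  nlinarith

/-- `g(t) → +∞` as `t ↑ 1`. [folklore] -/
theorem tendsto_gII_atTop : Tendsto (fun s : ℝ => (1 - s)⁻¹ - 1) (𝓝[<] (1 : ℝ)) atTop := by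
  have h3 : Tendsto (fun t : ℝ => (1 - t)⁻¹) (𝓝[<] (1 : ℝ)) atTop :=
    tendsto_inv_nhdsGT_zero.comp tendsto_one_sub_nhdsLT
  have h4 : Tendsto (fun t : ℝ => (1 - t)⁻¹ + (-1)) (𝓝[<] (1 : ℝ)) atTop :=
    tendsto_atTop_add_const_right _ _ h3
  exact h4.congr' (Eventually.of_forall fun t => by simp [sub_eq_add_neg])

/-- `|g| → ∞` as `t ↑ 1`. [folklore] -/
theorem tendsto_abs_gII_atTop :
    Tendsto (fun t : ℝ => |(1 - t)⁻¹ - 1|) (𝓝[<] (1 : ℝ)) atTop :=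
  tendsto_abs_atTop_atTop.comp tendsto_gII_atTop

/-- **The Type-II drift is not Type I**: `‖u(t, x)‖ = g(t) = t/(1 − t)`, and
`t/(1 − t) ≤ C/√(1 − t)` forces `t ≤ C √(1 − t)`, false for `t` near `1`. [folklore] -/
theorem drift_gII_not_isTypeIBlowup : ¬ IsTypeIBlowup (drift (fun s : ℝ => (1 - s)⁻¹ - 1)) 1 := by
  rintro ⟨C, hC⟩
  set δ : ℝ := 1 / (2 * (|C| + 1)) with hδ
  have hδpos : 0 < δ := by positivity
  have hsqrt : Tendsto (fun t : ℝ => Real.sqrt (1 - t)) (𝓝 (1 : ℝ)) (𝓝 0) := by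
    have hc : Continuous (fun t : ℝ => Real.sqrt (1 - t)) :=
      Real.continuous_sqrt.comp (continuous_const.sub continuous_id)
    simpa using hc.tendsto (1 : ℝ)
  have h3 : ∀ᶠ t in 𝓝[<] (1 : ℝ), Real.sqrt (1 - t) < δ :=
    (hsqrt.eventually (gt_mem_nhds hδpos)).filter_mono nhdsWithin_le_nhds
  have h2 : ∀ᶠ t in 𝓝[<] (1 : ℝ), t ∈ Ioo (1 / 2 : ℝ) 1 := Ioo_mem_nhdsLT (by norm_num)
  obtain ⟨t, ht, ht2, ht3⟩ := (hC.and (h2.and h3)).exists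
  have ht1 : t < 1 := ht2.2
  have h1t : 0 < 1 - t := sub_pos.2 ht1
  have hsq : 0 < Real.sqrt (1 - t) := Real.sqrt_pos.2 h1t
  have hle : |(1 - t)⁻¹ - 1| ≤ C / Real.sqrt (1 - t) := by simpa [norm_drift] using ht 0
  rw [abs_of_nonneg (gII_nonneg (by linarith [ht2.1]) ht1)] at hle
  -- `t = (1 - t) g(t) ≤ (1 - t) C / √(1 - t) = C √(1 - t)`
  have key : t ≤ C * Real.sqrt (1 - t) := by
    have h1 : (1 - t) * ((1 - t)⁻¹ - 1) ≤ (1 - t) * (C / Real.sqrt (1 - t)) :=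
      mul_le_mul_of_nonneg_left hle h1t.le
    rw [one_sub_mul_gII ht1] at h1
    have h2 : (1 - t) * (C / Real.sqrt (1 - t)) = C * Real.sqrt (1 - t) := by
      rw [mul_div_assoc', mul_comm (1 - t) C, mul_div_assoc, Real.div_sqrt]
    linarith [h2]
  have hlt : C * Real.sqrt (1 - t) < 1 / 2 :=
    calc C * Real.sqrt (1 - t) ≤ |C| * Real.sqrt (1 - t) :=
          mul_le_mul_of_nonneg_right (le_abs_self C) hsq.le
      _ ≤ |C| * δ := mul_le_mul_of_nonneg_left ht3.le (abs_nonneg C)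
      _ = |C| / (2 * (|C| + 1)) := by rw [hδ]; ring
      _ < 1 / 2 := by
          rw [div_lt_iff₀ (by positivity)]
          nlinarith [abs_nonneg C]
  linarith [ht2.1]

/-- The Type-II drift (`ν = 1`) is a maximal smooth solution with lifespan `1`: classical on
`[0, 1) × EuclideanSpace ℝ (Fin 3)` (`drift_isClassical`) with no classical extension past `1`
(`drift_not_hasSmoothExtensionPast`, `‖u(t, 0)‖ = |g(t)| → ∞`). [folklore] -/
theorem drift_gII_isMaximalSmoothSolution (ν : ℝ) :
    IsMaximalSmoothSolution ν 0 (drift (fun s : ℝ => (1 - s)⁻¹ - 1)) (driftP (fun s : ℝ => (1 - s)⁻¹ - 1)) 1 :=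
  ⟨drift_isClassical gII_contDiffOn ν, drift_not_hasSmoothExtensionPast tendsto_abs_gII_atTop ν⟩

/-! ## (a) Load-bearing: finite energy -/

/-- **Finite energy is load-bearing for `TypeIliouvilleNoTypeII`.**  The crux
`TypeILiouville.TypeIliouvilleNoTypeII` (item stmt-NavierStokesRegularity-0056) with its hypothesis
`IsLerayHopfOn T ν 0 (u 0) u` deleted — and nothing else changed — is FALSE: at `ν = T = 1` the
Type-II drift `u = g(t)·e₁`, `p = −g′(t) x₁`, `g(t) = (1 − t)⁻¹ − 1` is a maximal smooth solution
(`drift_gII_isMaximalSmoothSolution`) from the rapidly decaying datum `0` (`drift_rapidDecay`) which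
is not Type I (`drift_gII_not_isTypeIBlowup`).  Hence every proof of the crux uses the energy class
(Koch–Nadirashvili–Seregin–Šverák 2009, §1 p. 3: the parasitic solutions `u = b(t)`, `p = −b′(t)·x`
show that `L^∞`-type information alone never controls the time behaviour), and the crux is not
settled by junk: its other hypotheses are jointly satisfiable by a non-Type-I maximal solution.
[cite: KochNadirashviliSereginSverak2009, §1 p. 3 (parasitic solutions)] -/
theorem typeIliouvilleNoTypeII_false_without_lerayHopf :
    ¬ (∀ (ν T : ℝ), 0 < ν → 0 < T → ∀ (u : ℝ → EuclideanSpace ℝ (Fin 3) → EuclideanSpace ℝ (Fin 3))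
        (p : ℝ → EuclideanSpace ℝ (Fin 3) → ℝ),
        Literature.Analysis.FluidPDE.IsMaximalSmoothSolution ν 0 u p T →
        Literature.Analysis.FluidPDE.HasRapidSpatialDecay (u 0) →
        Literature.Analysis.FluidPDE.IsTypeIBlowup u T) := fun h =>
  drift_gII_not_isTypeIBlowup
    (h 1 1 one_pos one_pos _ _ (drift_gII_isMaximalSmoothSolution 1) (drift_rapidDecay gII_zero))

end Summit.NavierStokesRegularity.NavierStokesRegularity.Theorems.TypeIliouvilleNoTypeIINegative

end
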